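/-
Copyright (c) 2026 the pub-hodgecm-mathlib formalisation cell (harness21).  Prover seat hodgecm-mathlib-K2E3-p24 (g0), Track B «K2-LIT» ∕ h413
(`stmt-HodgeConjecture-24833`), line `K2_E3_EllipticInputs`, road (11-3-split-nsc) `sig_K2E3CharLocIntNearSemisimpleSplitThreeNonSupercuspidal` (U12 ED. 20 :419),
leaf (nsc-S-C′) «two-block cuspidal support ⇒ (GL-11)», brick F1 (nsc-S-C′-emb): THE SUPERCUSPIDAL SUPPORT AT A GIVEN JACQUET-MINIMAL LABELLING.  2026-09-04.
-/
import Literature.NumberTheory.Automorphic.ParabolicInductionSupportProofs   -- ★ BZ77 Thm. 2.5 road: `exists_isCoatom_subrepresentation_jacquetGL`, `coinvariantsKer_comp_cutUnipotent_eq_top`, `isSupercuspidal_of_forall_cut`, `exists_injective_intertwiningMap_parabolicIndGL`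
import Mathlib.Order.Hom.Set                                                  -- `StrictMono.orderIsoOfSurjective`
import Mathlib.Order.Fin.Basic                                                -- `Fin.coe_orderIso_apply`
import HarnessLib

/-!
# K2_E3 road (h413), leaf (nsc-S-C′), brick F1 — the supercuspidal support of an irreducible representation of `GL_n(F)` at a GIVEN
# Jacquet-minimal block labelling (Bernstein–Zelevinsky 1977, Thm. 2.5, proof), and the `GL₃` corollary «Borel Jacquet module zero,
# two-block Jacquet module non-zero ⇒ embedding into `Ind_{P_c}^{GL₃}(σ)` with `σ` irreducible supercuspidal of `GL₂ × GL₁` ∕ `GL₁ × GL₂`»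

Cell `pub/hodgecm-mathlib` (D-0151), Track B, seat K2E3-p24 (g0) = hand of the hosted leaf (nsc-S-C′) of (11-3-split-nsc) (road owner K2E3-p11 (g6),
BRICK LIST v2, `K2/STATUS.md` 2026-09-04 08:10:42Z; dealer K2E3-plan (g3) 08:10:54Z).  `--supports stmt-HodgeConjecture-24833 --as helper`; THEOREMS ONLY
(no definition ∕ instance ∕ notation ∕ named fact ∕ `sorry`); never imports `Cruxes/…/Lines`.  COUNT-NEUTRAL.

THE MATHEMATICS ([BernsteinZelevinsky1977, §2.4–2.5, Thm. 2.5]; [BernsteinZelevinsky1976, §3.19–3.21]; [Casselman1995, Thm. 5.1.2, §6.3]).  `F` a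
non-archimedean local field, `G = GL_n(F)`, `π` an irreducible smooth representation, `c : Fin n → Fin r` a monotone block labelling with standard parabolic
`P_c = M_c U_c`.  Call `c` **Jacquet-minimal for `π`** if the Jacquet module `r_c π = V ⧸ V(U_c)` is non-zero while for every one-cut refinement
`c′ = cutRefine c p` (the block of `p` cut after `p`, [BernsteinZelevinsky1977, Example 2.2]) the Jacquet module `r_{c′} π` vanishes.  Then — this is the
proof of [BernsteinZelevinsky1977, Thm. 2.5] run at THIS `c` instead of at a labelling with the maximal number of blocks (★ `bernsteinZelevinsky_support_holds`,
steps 2–5) — the finitely generated Jacquet module `r_c π` has an irreducible quotient `σ₀` (★ `exists_isCoatom_subrepresentation_jacquetGL`), `σ₀` is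
quasi-cuspidal because the cut coinvariants of a quotient of `r_c π` vanish as soon as `r_{c′} π = 0` (★ `coinvariantsKer_comp_cutUnipotent_eq_top`), hence
SUPERCUSPIDAL by Harish-Chandra's support theorem on the Levi (★ `isSupercuspidal_of_forall_cut`), and Frobenius reciprocity turns `r_c π ↠ σ₀` into an
INJECTIVE intertwining map `π ↪ i_c σ` with `σ = σ₀ ⊗ (δ_{P_c}^{1∕2} ∘ emb)⁻¹` irreducible, smooth, supercuspidal (★ `exists_injective_intertwiningMap_parabolicIndGL`,
★ `IsSupercuspidal.twist`).  For `GL₃`: if the BOREL Jacquet module of `π` vanishes (`c = id`), every two-block labelling `c : Fin 3 → Fin 2` with `r_c π ≠ 0`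
is Jacquet-minimal, because a one-cut refinement of a surjective two-block labelling is a monotone SURJECTIVE self-map of `Fin 3`, i.e. the identity
(Mathlib `Fin.coe_orderIso_apply`).  This is the first step «quasi-cuspidal quotient supercuspidal ⇒ `r₀ ↪ ρ × χ` ∕ `χ × ρ`» of the leaf (nsc-S-C′)
(BRICK LIST v2 08:10:42Z: «[BZ1977 Thm. 2.5 proof, ★ `isSupercuspidal_of_forall_cut`]»).

* `eq_id_of_monotone_surjective` — a monotone surjective `Fin n → Fin n` is the identity (pure order theory).
* **`exists_supercuspidal_injective_of_jacquet_minimal`** — generic `n`, any monotone `c` (no surjectivity needed), `Nontrivial (r_c π)` and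
  `Subsingleton (r_{cutRefine c p} π)` for every proper cut ⟹ `∃ W σ, σ.IsIrreducible ∧ σ.IsSmooth ∧ σ.IsSupercuspidal ∧ ∃ f : π →ᵢ i_c σ, Injective f`
  (`W : Type u` in the universe of `F`, as in ★ `bernsteinZelevinsky_support`).
* **`exists_supercuspidal_injective_of_forall_succ_subsingleton`** — generic `n`, `c : Fin n → Fin r` monotone surjective with `r_c π ≠ 0` and ALL monotone
  surjective `(r+1)`-block labellings having zero Jacquet module ⟹ same conclusion.
* **`exists_supercuspidal_injective_of_borel_subsingleton_three`** — `GL₃(F)`: `r_{id} π = 0`, `c : Fin 3 → Fin 2` monotone surjective, `r_c π ≠ 0` ⟹ same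
  conclusion (the (nsc-S-C′) hypotheses of BRICK LIST v2, verbatim vocabulary `Subsingleton ∕ Nontrivial (restrictUnipotentGL F _ π).Coinvariants`).

HONEST LABEL: HC_CM is proved only modulo the 7 printed citations (2 remaining named inputs: hLiu418 = stmt-HodgeConjecture-24832, h413 =
stmt-HodgeConjecture-24833) until rung 0 closes; count-neutral helper; the irreducibility of `i_c σ` [Zelevinsky1980, Thm. 4.2] and van Dijk's character formula
for `i_c σ` are NOT touched here.

## References
* [BernsteinZelevinsky1977] I. N. Bernstein, A. V. Zelevinsky, *Induced representations of reductive 𝔭-adic groups I*, Ann. Sci. ÉNS (4) 10 (1977), 441–472,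
  §2.4–2.5, Thm. 2.5 (held `paper:doi-10-24033-asens-1333`, p. 447), Example 2.2.
* [BernsteinZelevinsky1976] I. N. Bernstein, A. V. Zelevinsky, *Representations of the group GL(n, F) where F is a non-archimedean local field*, Russian Math.
  Surveys 31:3 (1976), 1–68, §3.19–3.21.
* [Casselman1995] W. Casselman, *Introduction to the theory of admissible representations of 𝔭-adic reductive groups* (1995 notes), Thm. 5.1.2, §6.3.
* [Zelevinsky1980] A. V. Zelevinsky, *Induced representations of reductive 𝔭-adic groups II*, Ann. Sci. ÉNS (4) 13 (1980), 165–210, Thm. 4.2.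
-/

set_option autoImplicit false
set_option linter.dupNamespace false

noncomputable section

open scoped MatrixGroups

namespace Summit.HodgeConjecture.HodgeConjecture.Cruxes.H413.K2E3TwoBlockCuspidalSupportEmbedding

open Literature.NumberTheory.Automorphic Representation

universe u

/-! ## §0  A monotone surjective self-map of `Fin n` is the identity -/

/-- A monotone surjective map `Fin n → Fin n` is the identity: surjective self-maps of a finite type are bijective, a monotone injection is strictly
monotone, and an order automorphism of `Fin n` fixes every element (Mathlib `Fin.coe_orderIso_apply`). [folklore] -/
theorem eq_id_of_monotone_surjective {n : ℕ} {f : Fin n → Fin n} (hf : Monotone f) (hs : Function.Surjective f) : f = id := by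
  have hinj : Function.Injective f := Finite.injective_iff_surjective.2 hs
  have hsm : StrictMono f := hf.strictMono_of_injective hinj
  funext i
  have h := Fin.coe_orderIso_apply (hsm.orderIsoOfSurjective f hs) i
  rw [StrictMono.coe_orderIsoOfSurjective] at h
  exact Fin.ext h

/-! ## §1  The supercuspidal support at a Jacquet-minimal labelling (generic `n`) -/

section Generic

variable (F : Type u) [Field F] [ValuativeRel F] [TopologicalSpace F] [IsNonarchimedeanLocalField F]
  {n : ℕ} {V : Type*} [AddCommGroup V] [Module ℂ V]

/-- **[BernsteinZelevinsky1977, Thm. 2.5 — proof at a given Jacquet-minimal labelling].**  Let `π` be an irreducible smooth representation of `GL_n(F)` and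
`c : Fin n → Fin r` a monotone block labelling such that the Jacquet module `r_c π` is non-zero while `r_{c′} π = 0` for every one-cut refinement
`c′ = cutRefine c p` (`p < q`, `c q = c p`).  Then there are a complex vector space `W` (in the universe of `F`) and an irreducible smooth SUPERCUSPIDAL
representation `σ` of the block Levi `Π_a GL_{n_a}(F)` on `W` together with an INJECTIVE intertwining map `π ↪ i_c σ` (`i_c = parabolicIndGL F c`,
normalised induction).  Steps: irreducible quotient `σ₀` of the finitely generated `r_c π`; quasi-cuspidality of `σ₀` from `r_{c′} π = 0`;
Harish-Chandra's support theorem on the Levi; twist by `(δ^{1∕2} ∘ emb)⁻¹`; Frobenius reciprocity.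
[cite: BernsteinZelevinsky1977, §2.4–2.5, Thm. 2.5 p. 447] [cite: Casselman1995, Thm. 5.1.2, §6.3] -/
theorem exists_supercuspidal_injective_of_jacquet_minimal
    (π : Representation ℂ (GL (Fin n) F) V) [π.IsIrreducible] (hπ : π.IsSmooth)
    {r : ℕ} {c : Fin n → Fin r} (hc : Monotone c)
    (hnt : Nontrivial (restrictUnipotentGL F c π).Coinvariants)
    (hcut : ∀ p q : Fin n, p < q → c q = c p → Subsingleton (restrictUnipotentGL F (cutRefine c p) π).Coinvariants) :
    ∃ (W : Type u) (_ : AddCommGroup W) (_ : Module ℂ W) (σ : Representation ℂ (Π a, GL {i // c i = a} F) W),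
      σ.IsIrreducible ∧ σ.IsSmooth ∧ σ.IsSupercuspidal ∧
        ∃ f : π.IntertwiningMap (parabolicIndGL F c σ), Function.Injective f := by
  classical
  haveI : IsTopologicalRing F := inferInstance
  haveI := hnt
  -- an irreducible quotient `σ₀` of `r_c π`, moved into the universe of `F`
  obtain ⟨N, hN⟩ := exists_isCoatom_subrepresentation_jacquetGL F c π hπ
  haveI hirr₀ : N.quotientRep.IsIrreducible := Subrepresentation.isIrreducible_quotientRep hN
  have hsm₀ : N.quotientRep.IsSmooth := (hπ.jacquetGL F c).quotientRep N
  obtain ⟨N', σ₀, ⟨e₀⟩⟩ := IsIrreducible.exists_equiv_quotient_finsupp N.quotientRep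
  haveI hirr : σ₀.IsIrreducible := e₀.isIrreducible
  have hsm : σ₀.IsSmooth := e₀.isSmooth hsm₀
  -- the quotient map `ψ : r_c π → σ₀`: surjective and non-zero
  let ψ : (jacquetGL F c π).IntertwiningMap σ₀ := e₀.toIntertwiningMap.comp N.mkQ
  have hψs : Function.Surjective ψ := fun w => by
    obtain ⟨x, hx⟩ := N.mkQ_surjective (e₀.symm w)
    exact ⟨x, by simp [ψ, hx]⟩
  have hψ0 : ψ ≠ 0 := by
    intro h
    apply hN.1
    refine le_antisymm le_top fun x _ => ?_
    have hx : ψ x = 0 := by rw [h]; rfl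
    have hx' : N.mkQ x = 0 := by
      have := congrArg e₀.symm hx
      simpa [ψ] using this
    exact (N.mkQ_eq_zero_iff x).1 hx'
  -- quasi-cuspidality of `σ₀` from the vanishing of the refined Jacquet modules
  have hQC : ∀ p q : Fin n, p < q → c q = c p → Coinvariants.ker (σ₀.comp (cutUnipotent F c p).subtype) = ⊤ := by
    intro p q hpq hq
    refine coinvariantsKer_comp_cutUnipotent_eq_top F hc p π ?_ σ₀ ψ hψs
    have h := hcut p q hpq hq
    change Subsingleton (V ⧸ Coinvariants.ker (restrictUnipotentGL F (cutRefine c p) π)) at h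
    exact Submodule.Quotient.subsingleton_iff.1 h
  -- `σ₀` is supercuspidal, and so is its twist by `(δ^{1/2} ∘ emb)⁻¹`
  have hsc₀ : σ₀.IsSupercuspidal := σ₀.isSupercuspidal_of_forall_cut hc hsm hQC
  set χ : (Π a, GL {i // c i = a} F) →* ℂˣ := (rootDeltaChar (standardParabolicGL F c)).comp (leviEmbeddingP F c) with hχ
  have hsc : (σ₀.twist χ⁻¹).IsSupercuspidal := IsSupercuspidal.twist σ₀ hsc₀ χ⁻¹ (isOpen_ker_rootDeltaChar_comp_leviEmbeddingP_inv F c)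
  -- Frobenius reciprocity
  obtain ⟨f, hf⟩ := exists_injective_intertwiningMap_parabolicIndGL F c π hπ σ₀ ψ hψ0
  exact ⟨_, inferInstance, inferInstance, σ₀.twist χ⁻¹, isIrreducible_twist_rootDeltaChar_inv F c σ₀, hsm.twist_rootDeltaChar_inv F c, hsc, f, hf⟩

/-- **The supercuspidal support at a labelling with the maximal number of blocks below which everything vanishes** (generic `n`): if `c : Fin n → Fin r` is
monotone and surjective with `r_c π ≠ 0`, and EVERY monotone surjective labelling with `r + 1` blocks has zero Jacquet module, then `π ↪ i_c σ` for some
irreducible smooth supercuspidal `σ` of the block Levi (the one-cut refinements `cutRefine c p` are monotone surjective with `r + 1` blocks, ★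
`cutRefine_monotone`, ★ `cutRefine_surjective`). [cite: BernsteinZelevinsky1977, §2.4–2.5, Thm. 2.5 p. 447] -/
theorem exists_supercuspidal_injective_of_forall_succ_subsingleton
    (π : Representation ℂ (GL (Fin n) F) V) [π.IsIrreducible] (hπ : π.IsSmooth)
    {r : ℕ} {c : Fin n → Fin r} (hc : Monotone c) (hcs : Function.Surjective c)
    (hnt : Nontrivial (restrictUnipotentGL F c π).Coinvariants)
    (hsucc : ∀ c' : Fin n → Fin (r + 1), Monotone c' → Function.Surjective c' → Subsingleton (restrictUnipotentGL F c' π).Coinvariants) :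
    ∃ (W : Type u) (_ : AddCommGroup W) (_ : Module ℂ W) (σ : Representation ℂ (Π a, GL {i // c i = a} F) W),
      σ.IsIrreducible ∧ σ.IsSmooth ∧ σ.IsSupercuspidal ∧
        ∃ f : π.IntertwiningMap (parabolicIndGL F c σ), Function.Injective f :=
  exists_supercuspidal_injective_of_jacquet_minimal F π hπ hc hnt fun p _ hpq hq =>
    hsucc (cutRefine c p) (cutRefine_monotone hc p) (cutRefine_surjective hc hcs hpq hq)

end Generic

/-! ## §2  `GL₃(F)`: Borel Jacquet module zero, a two-block Jacquet module non-zero -/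

section Three

variable (F : Type u) [Field F] [ValuativeRel F] [TopologicalSpace F] [IsNonarchimedeanLocalField F]
  {V : Type*} [AddCommGroup V] [Module ℂ V]

/-- **(nsc-S-C′-emb) Two-block cuspidal support for `GL₃(F)`.**  Let `π` be an irreducible smooth representation of `GL₃(F)` whose BOREL Jacquet module
vanishes (`Subsingleton (restrictUnipotentGL F id π).Coinvariants`) and let `c : Fin 3 → Fin 2` be a monotone surjective labelling (`P_c = P_{(2,1)}` or
`P_{(1,2)}`) with `r_c π ≠ 0`.  Then `π` embeds into `i_c σ` for an irreducible smooth SUPERCUSPIDAL representation `σ` of the block Levi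
`GL₂(F) × GL₁(F)` ∕ `GL₁(F) × GL₂(F)`: the one-cut refinements of `c` are monotone surjective self-maps of `Fin 3`, i.e. the identity
(`eq_id_of_monotone_surjective`), so `c` is Jacquet-minimal and `exists_supercuspidal_injective_of_forall_succ_subsingleton` applies.  First step of the leaf
(nsc-S-C′) «`r₀ ↪ ρ × χ` ∕ `χ × ρ`». [cite: BernsteinZelevinsky1977, §2.4–2.5, Thm. 2.5 p. 447] [cite: Casselman1995, Thm. 5.1.2, §6.3] -/
theorem exists_supercuspidal_injective_of_borel_subsingleton_three
    (π : Representation ℂ (GL (Fin 3) F) V) [π.IsIrreducible] (hπ : π.IsSmooth)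
    (hB : Subsingleton (restrictUnipotentGL F (id : Fin 3 → Fin 3) π).Coinvariants)
    {c : Fin 3 → Fin 2} (hc : Monotone c) (hcs : Function.Surjective c)
    (hnt : Nontrivial (restrictUnipotentGL F c π).Coinvariants) :
    ∃ (W : Type u) (_ : AddCommGroup W) (_ : Module ℂ W) (σ : Representation ℂ (Π a, GL {i // c i = a} F) W),
      σ.IsIrreducible ∧ σ.IsSmooth ∧ σ.IsSupercuspidal ∧
        ∃ f : π.IntertwiningMap (parabolicIndGL F c σ), Function.Injective f := by
  refine exists_supercuspidal_injective_of_forall_succ_subsingleton F π hπ hc hcs hnt fun c' hc' hc's => ?_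
  obtain rfl : c' = id := eq_id_of_monotone_surjective hc' hc's
  exact hB

end Three

end Summit.HodgeConjecture.HodgeConjecture.Cruxes.H413.K2E3TwoBlockCuspidalSupportEmbedding

end
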